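import Summits.QuantumFields.YangMills.Theses.SqueezedSkewness
import Summits.QuantumFields.YangMills.Theorems.ThermalDescentElectricSeamGlue

/-!
# Birth skeleton for the SHARED crux `ElectricSeam` (item stmt-QuantumFields-25582) on route SqueezedSkewness

Planner ym-idea-6 g8 — REPAIR R1 after the (accidental) close of route ThermalDescent, on which this item's
split (gen 1: SeamFromMoments 27002 · FloorUnitMoments 27003 · glue ElectricSeamGlue 27004, PROVED
`Summit.QuantumFields.YangMills.Theorems.thermalDescent_electricSeamGlue`) lived.  The two stubs below are those two
child statements BY NAME (their decls stay in the kept route file `Theses/ThermalDescent.lean`); the composition is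
the landed glue.  This re-serves the decomposition through the crux protocol on the live route; no new mathematics,
no summit / NT statement is proved here.

* `stub_seamFromMoments` (support, M; lattice analysis provable now): Bałaban-class sixth-moment ceilings
  `MomentBounds6 G r a` at the floor-carrying unit ⇒ the electric seam's RP-norm² is ≤ η·(floor scale) — two powers of
  `a` to spare (pointers: Cruxes/NT evidence on 27002/27003, ideator g4).
* `stub_floorUnitMoments` (crux, XL-by-dependency): the ceiling itself, typed verbatim as the spine's
  `DlrCollarTransfer.MomentBounds6 G r a` at every floor-carrying unit (= the moment half of UVSeamRec's output).
-/

namespace Summit.QuantumFields.YangMills.Cruxes.NT.ElectricSeamBirth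

/-! ## Name-keyed statements of the two registered stubs -/
namespace __Registered

/-- Statement of `stub_seamFromMoments` = `ThermalDescent.SeamFromMoments` (item stmt-QuantumFields-27002). -/
abbrev stub_seamFromMoments : Prop :=
  Summit.QuantumFields.YangMills.Theses.ThermalDescent.SeamFromMoments

/-- Statement of `stub_floorUnitMoments` = `ThermalDescent.FloorUnitMoments` (item stmt-QuantumFields-27003). -/
abbrev stub_floorUnitMoments : Prop :=
  Summit.QuantumFields.YangMills.Theses.ThermalDescent.FloorUnitMoments

end __Registered

/-! ## The two registered stubs — the ONLY `sorry`s of this file -/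

/-- stub (M): seam from moments.  OPEN (provable now). -/
theorem stub_seamFromMoments : __Registered.stub_seamFromMoments := by
  sorry

/-- stub (XL): the sixth-moment ceilings at the floor-carrying unit.  OPEN. -/
theorem stub_floorUnitMoments : __Registered.stub_floorUnitMoments := by
  sorry

/-! ## Composition: the crux BY NAME (item decl `ThermalDescent.ElectricSeam`; SqueezedSkewness copy below) from the two stub statements — no `sorry` below -/

/-- **ElectricSeam_of** — the landed glue `thermalDescent_electricSeamGlue` (item stmt-QuantumFields-25582, primary decl
`ThermalDescent.ElectricSeam`). -/
theorem ElectricSeam_of (h1 : __Registered.stub_seamFromMoments)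
    (h2 : __Registered.stub_floorUnitMoments) :
    Summit.QuantumFields.YangMills.Theses.ThermalDescent.ElectricSeam :=
  Summit.QuantumFields.YangMills.Theorems.thermalDescent_electricSeamGlue h1 h2

/-- The same composition read against the SqueezedSkewness copy of the shared statement (identical text; the two
`def`s are definitionally equal, checked here by `exact`). -/
theorem squeezedSkewness_electricSeam_of_stubs (h1 : __Registered.stub_seamFromMoments)
    (h2 : __Registered.stub_floorUnitMoments) :
    Summit.QuantumFields.YangMills.Theses.SqueezedSkewness.ElectricSeam :=
  ElectricSeam_of h1 h2

end Summit.QuantumFields.YangMills.Cruxes.NT.ElectricSeamBirth
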